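import Mathlib
import HarnessLib
import Summits.Ventures.LatticeQCDFlow.Scoring.SampleQuantileCLT
import Summits.Ventures.LatticeQCDFlow.Scoring.CdfConvergence
import Summits.Ventures.LatticeQCDFlow.Scoring.AgreementTestPower

/-!
# The iid sample-quantile CLT IN DISTRIBUTION, `√n (q̂ₙ − q) ⇒ −W/f ∼ N(0, u(1−u)/f²)`, and the
# A-vs-B criterion for a QUANTILE COLUMN of two independent iid codes: nominal asymptotic coverage
# `N(0,1)([−z, z])` when the two laws share the `u`-quantile, power → 1 when they do not

HONEST FRAMING: exact (Metropolis-corrected) sampling algorithms for lattice gauge theory;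
figures of merit are autocorrelation/cost numbers at stated couplings and volumes; no
continuum-physics claim.

Venture `LatticeQCDFlow` (cell pub-lqcd), topic `Scoring`; FANOUT row 4 (`s0-u1-b`, rung S0-B).
Row 4's `Scoring/SampleQuantileCLT.sampleQuantile_clt_cdf` (GEN-27) is the sample-quantile
central limit theorem for iid draws in distribution-function form, `P(√n (q̂ₙ − q) ≤ x) →
P(−x·f ≤ W)`, `W ∼ N(0, u(1−u))`.  This file (GEN-28, re-typing the two GEN-27 sequels whose
proposals bounced on an import-ordering error during the farm's olean lag) converts it into a
`TendstoInDistribution` statement with the limit variable `−W/f` (**`sampleQuantile_clt`**; law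
`N(0, u(1−u)/f²)` by **`hasLaw_neg_div_gaussian`**; measurability of the empirical quantile,
**`measurable_empiricalQuantile`**, from its Galois connection; the conversion is
`CdfConvergence.tendstoInDistribution_of_tendsto_cdf`), and composes it with the abstract two-code
theorems of `Scoring/AsymptoticCoverage` and `Scoring/AgreementTestPower`:
**`twoCode_quantile_agreement_coverage`** — two independent iid codes whose laws share the
`u`-quantile `q` with positive derivatives `f_A, f_B` of their distribution functions there, printed
squared standard errors `V̂ₙ^X` (measurable) with `n·V̂ₙ^X → u(1−u)/f_X²` in probability (e.g. the
plug-in bar of `Scoring/SampleQuantileStdErr`), code B read along `mₙ → ∞`: for every `z`,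
`(P_A ⊗ P_B)(|q̂^A_n − q̂^B_{mₙ}| ≤ z·√(V̂^A_n + V̂^B_{mₙ})) → N(0,1)([−z, z])`;
**`twoCode_quantile_agreement_power`** — if instead the `u`-quantiles differ (`q_A ≠ q_B`), the
criterion holds with probability `→ 0`.  The Markov-chain version is `Scoring/ChainQuantileAgreement`.
NEW WORK of the cell; no definition; nothing cited as a fact.

## Content

* `measurable_empiricalQuantile`, `hasLaw_neg_div_gaussian`, **`sampleQuantile_clt`**;
* **`twoCode_quantile_agreement_coverage`**, **`twoCode_quantile_agreement_power`**.

NOT CLAIMED: dependent draws (see the chain files); `f = 0`; a rate; a consistent estimator of a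
quantile's standard error other than by hypothesis (`Scoring/SampleQuantileStdErr` discharges it
for the plug-in spacing bar).
-/

noncomputable section

namespace Summit.Ventures.LatticeQCDFlow.Scoring.GlivenkoCantelli

open MeasureTheory ProbabilityTheory Finset Filter Function
open scoped Topology ENNReal NNReal

/-! ## §1 The iid sample-quantile CLT in distribution -/

section CLT

variable {Ω : Type*} [MeasurableSpace Ω] {P : Measure Ω} [IsProbabilityMeasure P]
variable {Ω' : Type*} [MeasurableSpace Ω'] {P' : Measure Ω'} [IsProbabilityMeasure P']
variable {X : ℕ → Ω → ℝ}

/-- **The empirical `u`-quantile of `n` measurable real variables is measurable** (`u ∈ (0,1)`).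
[folklore] (`{q̂ ≤ b} = {u ≤ F̂ₙ(b)}` by the Galois connection; `n = 0` gives a constant) -/
theorem measurable_empiricalQuantile (hXm : ∀ i, Measurable (X i)) {u : ℝ} (hu0 : 0 < u)
    (hu1 : u < 1) (n : ℕ) :
    Measurable fun ω =>
      sInf {s | u ≤ cdf (((n : ℝ≥0∞)⁻¹) • ∑ i ∈ range n, Measure.dirac (X i ω)) s} := by
  rcases Nat.eq_zero_or_pos n with hn | hn
  · subst hn
    simp only [Finset.range_zero, Finset.sum_empty]
    exact measurable_const
  · have hn1 : 1 ≤ n := hn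
    refine measurable_of_Iic fun b => ?_
    have hset : (fun ω =>
        sInf {s | u ≤ cdf (((n : ℝ≥0∞)⁻¹) • ∑ i ∈ range n, Measure.dirac (X i ω)) s}) ⁻¹' Set.Iic b
        = {ω | u ≤ (∑ i ∈ range n, (Set.Iic b).indicator (1 : ℝ → ℝ) (X i ω)) / n} := by
      ext ω
      simp only [Set.mem_preimage, Set.mem_Iic, Set.mem_setOf_eq]
      haveI := isProbabilityMeasure_empiricalMeasure (fun i => X i ω) hn1
      obtain ⟨-, -, hgal⟩ :=
        cdf_quantile_spec (((n : ℝ≥0∞)⁻¹) • ∑ i ∈ range n, Measure.dirac (X i ω)) hu0 hu1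
      rw [hgal b, cdf_empiricalMeasure (fun i => X i ω) hn1 b]
    rw [hset]
    exact measurableSet_le measurable_const
      ((Finset.measurable_sum _ fun i _ =>
        (measurable_one.indicator measurableSet_Iic).comp (hXm i)).div_const _)

omit [IsProbabilityMeasure P'] in
/-- `W ∼ N(0, c.toNNReal)` ⇒ `−W/f ∼ N(0, (c/f²).toNNReal)`. [folklore] (Mathlib's
`gaussianReal_neg`, `gaussianReal_div_const`, variance rewritten) -/
theorem hasLaw_neg_div_gaussian {W : Ω' → ℝ} {c : ℝ}
    (hW : HasLaw W (gaussianReal 0 c.toNNReal) P') (f : ℝ) :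
    HasLaw (fun ω => -W ω / f) (gaussianReal 0 ((c / f ^ 2).toNNReal)) P' := by
  have h := gaussianReal_div_const (gaussianReal_neg hW) f
  have e1 : -(0 : ℝ) / f = 0 := by simp
  have e2 : c.toNNReal / NNReal.mk (f ^ 2) (sq_nonneg _) = (c / f ^ 2).toNNReal := by
    rw [Real.toNNReal_div' (sq_nonneg _)]
    congr 1
    exact NNReal.eq (by rw [Real.coe_toNNReal _ (sq_nonneg f)]; rfl)
  rw [e1, e2] at h
  exact h

/-- **THE SAMPLE-QUANTILE CLT FOR IID DRAWS, IN DISTRIBUTION.**  iid real `Xᵢ` with law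
`ρ = P ∘ X₀⁻¹`, `F = cdf ρ`, `F(q) = u ∈ (0,1)`, `F′(q) = f > 0`; `W ∼ N(0, u(1−u))` on an auxiliary
space.  With the empirical quantile `q̂ₙ = inf{s : u ≤ cdf(n⁻¹Σ_{i<n} δ_{Xᵢ}) s}`:
`√n (q̂ₙ − q) ⇒ −W/f`, whose law is `N(0, u(1−u)/f²)`. [ours] (GEN-27's distribution-function form
`sampleQuantile_clt_cdf` + `CdfConvergence.tendstoInDistribution_of_tendsto_cdf`) -/
theorem sampleQuantile_clt (hXm : ∀ i, Measurable (X i)) (hind : iIndepFun X P)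
    (hid : ∀ i, IdentDistrib (X i) (X 0) P P) {u q f : ℝ} (hu0 : 0 < u) (hu1 : u < 1)
    (hFq : cdf (P.map (X 0)) q = u) (hderiv : HasDerivAt (fun s => cdf (P.map (X 0)) s) f q)
    (hf : 0 < f) {W : Ω' → ℝ} (hW : HasLaw W (gaussianReal 0 (u * (1 - u)).toNNReal) P') :
    TendstoInDistribution (fun (n : ℕ) ω => Real.sqrt n
        * (sInf {s | u ≤ cdf (((n : ℝ≥0∞)⁻¹) • ∑ i ∈ range n, Measure.dirac (X i ω)) s} - q))
      atTop (fun ω' => -W ω' / f) (fun _ => P) P' := by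
  refine CardConsistency.tendstoInDistribution_of_tendsto_cdf
    (fun n => (measurable_const.mul
      ((measurable_empiricalQuantile hXm hu0 hu1 n).sub_const q)).aemeasurable)
    (hW.aemeasurable.neg.div_const f) fun x => ?_
  have h := sampleQuantile_clt_cdf hXm hind hid hu0 hu1 hFq hderiv hW x
  have e : {ω' | -W ω' / f ≤ x} = {ω' | -(x * f) ≤ W ω'} := by
    ext ω'
    simp only [Set.mem_setOf_eq]
    rw [div_le_iff₀ hf]
    constructor <;> intro h' <;> linarith
  rw [e]
  exact h

end CLT

/-! ## §2 The two-code quantile agreement test: coverage and power -/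

section Agreement

variable {ΩA : Type*} [MeasurableSpace ΩA] {PA : Measure ΩA} [IsProbabilityMeasure PA]
variable {ΩB : Type*} [MeasurableSpace ΩB] {PB : Measure ΩB} [IsProbabilityMeasure PB]
variable {Ω' : Type*} [MeasurableSpace Ω'] {P' : Measure Ω'} [IsProbabilityMeasure P']
variable {X : ℕ → ΩA → ℝ} {Y : ℕ → ΩB → ℝ} {WA WB Z : Ω' → ℝ}

/-- **A VS B FOR A QUANTILE COLUMN HAS ITS NOMINAL ASYMPTOTIC COVERAGE.**  Independent iid codes
`Xᵢ` on `(Ω_A, P_A)`, `Yⱼ` on `(Ω_B, P_B)`, distribution functions `F_A`, `F_B` with the SAME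
`u`-quantile `q` (`F_A(q) = u = F_B(q)`, `u ∈ (0,1)`) and derivatives `f_A, f_B > 0` there;
`W_A, W_B ∼ N(0, u(1−u))`, `Z ∼ N(0,1)` on an auxiliary space; printed squared standard errors
`V̂^A_n`, `V̂^B_n` measurable with `n·V̂^X_n → u(1−u)/f_X²` in probability; `mₙ → ∞`.  Then for
every `z`:
`(P_A ⊗ P_B)(|(q̂^A_n − q̂^B_{mₙ})/√(V̂^A_n + V̂^B_{mₙ})| ≤ z) → N(0,1)([−z, z])`. [ours] -/
theorem twoCode_quantile_agreement_coverage
    (hXm : ∀ i, Measurable (X i)) (hindX : iIndepFun X PA)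
    (hidX : ∀ i, IdentDistrib (X i) (X 0) PA PA)
    (hYm : ∀ i, Measurable (Y i)) (hindY : iIndepFun Y PB)
    (hidY : ∀ i, IdentDistrib (Y i) (Y 0) PB PB)
    {u q fA fB : ℝ} (hu0 : 0 < u) (hu1 : u < 1)
    (hFqA : cdf (PA.map (X 0)) q = u) (hderA : HasDerivAt (fun s => cdf (PA.map (X 0)) s) fA q)
    (hfA : 0 < fA)
    (hFqB : cdf (PB.map (Y 0)) q = u) (hderB : HasDerivAt (fun s => cdf (PB.map (Y 0)) s) fB q)
    (hfB : 0 < fB)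
    (hWA : HasLaw WA (gaussianReal 0 (u * (1 - u)).toNNReal) P')
    (hWB : HasLaw WB (gaussianReal 0 (u * (1 - u)).toNNReal) P')
    {VA : ℕ → ΩA → ℝ} {VB : ℕ → ΩB → ℝ} (hVAm : ∀ n, Measurable (VA n))
    (hVBm : ∀ n, Measurable (VB n))
    (hVA : TendstoInMeasure PA (fun (n : ℕ) ω => (n : ℝ) * VA n ω) atTop
      fun _ => u * (1 - u) / fA ^ 2)
    (hVB : TendstoInMeasure PB (fun (n : ℕ) ω => (n : ℝ) * VB n ω) atTop
      fun _ => u * (1 - u) / fB ^ 2)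
    {m : ℕ → ℕ} (hm : Tendsto m atTop atTop) (hZ : HasLaw Z (gaussianReal 0 1) P') (z : ℝ) :
    Tendsto (fun n : ℕ => (PA.prod PB).real {ω : ΩA × ΩB |
        |(sInf {s | u ≤ cdf (((n : ℝ≥0∞)⁻¹) • ∑ i ∈ range n, Measure.dirac (X i ω.1)) s}
          - sInf {s | u ≤ cdf ((((m n : ℕ) : ℝ≥0∞)⁻¹)
              • ∑ i ∈ range (m n), Measure.dirac (Y i ω.2)) s})
          / Real.sqrt (VA n ω.1 + VB (m n) ω.2)| ≤ z})
      atTop (𝓝 ((gaussianReal 0 1).real (Set.Icc (-z) z))) := by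
  have huu : 0 < u * (1 - u) := mul_pos hu0 (by linarith)
  have hA := sampleQuantile_clt hXm hindX hidX hu0 hu1 hFqA hderA hfA hWA
  have hB := sampleQuantile_clt hYm hindY hidY hu0 hu1 hFqB hderB hfB hWB
  have hsA : 0 < u * (1 - u) / fA ^ 2 := by positivity
  have hsB : 0 < u * (1 - u) / fB ^ 2 := by positivity
  have hZA := hasLaw_neg_div_gaussian hWA fA
  have hZB := hasLaw_neg_div_gaussian hWB fB
  exact CardConsistency.twoSample_agreement_coverage hsA hsB
    (fun n => measurable_empiricalQuantile hXm hu0 hu1 n) hVAm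
    (fun n => measurable_empiricalQuantile hYm hu0 hu1 n) hVBm hA hZA hB hZB hVA hVB hm hZ z

/-- **A VS B FOR A QUANTILE COLUMN HAS POWER TENDING TO ONE AGAINST DIFFERENT QUANTILES.**  Same
two codes, but the `u`-quantiles differ: `F_A(q_A) = u = F_B(q_B)`, `q_A ≠ q_B`, derivatives
`f_A, f_B > 0`; nonnegative printed squared standard errors with `n·V̂^X_n → u(1−u)/f_X²` in
probability; `mₙ → ∞`.  Then for every `z`:
`(P_A ⊗ P_B)(|(q̂^A_n − q̂^B_{mₙ})/√(V̂^A_n + V̂^B_{mₙ})| ≤ z) → 0`. [ours] -/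
theorem twoCode_quantile_agreement_power
    (hXm : ∀ i, Measurable (X i)) (hindX : iIndepFun X PA)
    (hidX : ∀ i, IdentDistrib (X i) (X 0) PA PA)
    (hYm : ∀ i, Measurable (Y i)) (hindY : iIndepFun Y PB)
    (hidY : ∀ i, IdentDistrib (Y i) (Y 0) PB PB)
    {u qA qB fA fB : ℝ} (hu0 : 0 < u) (hu1 : u < 1) (hq : qA ≠ qB)
    (hFqA : cdf (PA.map (X 0)) qA = u) (hderA : HasDerivAt (fun s => cdf (PA.map (X 0)) s) fA qA)
    (hfA : 0 < fA)
    (hFqB : cdf (PB.map (Y 0)) qB = u) (hderB : HasDerivAt (fun s => cdf (PB.map (Y 0)) s) fB qB)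
    (hfB : 0 < fB)
    (hWA : HasLaw WA (gaussianReal 0 (u * (1 - u)).toNNReal) P')
    (hWB : HasLaw WB (gaussianReal 0 (u * (1 - u)).toNNReal) P')
    {VA : ℕ → ΩA → ℝ} {VB : ℕ → ΩB → ℝ} (hVA0 : ∀ n ω, 0 ≤ VA n ω) (hVB0 : ∀ n ω, 0 ≤ VB n ω)
    (hVA : TendstoInMeasure PA (fun (n : ℕ) ω => (n : ℝ) * VA n ω) atTop
      fun _ => u * (1 - u) / fA ^ 2)
    (hVB : TendstoInMeasure PB (fun (n : ℕ) ω => (n : ℝ) * VB n ω) atTop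
      fun _ => u * (1 - u) / fB ^ 2)
    {m : ℕ → ℕ} (hm : Tendsto m atTop atTop) (z : ℝ) :
    Tendsto (fun n : ℕ => (PA.prod PB).real {ω : ΩA × ΩB |
        |(sInf {s | u ≤ cdf (((n : ℝ≥0∞)⁻¹) • ∑ i ∈ range n, Measure.dirac (X i ω.1)) s}
          - sInf {s | u ≤ cdf ((((m n : ℕ) : ℝ≥0∞)⁻¹)
              • ∑ i ∈ range (m n), Measure.dirac (Y i ω.2)) s})
          / Real.sqrt (VA n ω.1 + VB (m n) ω.2)| ≤ z})
      atTop (𝓝 0) := by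
  have hA := sampleQuantile_clt hXm hindX hidX hu0 hu1 hFqA hderA hfA hWA
  have hB := sampleQuantile_clt hYm hindY hidY hu0 hu1 hFqB hderB hfB hWB
  have hsA : 0 < u * (1 - u) / fA ^ 2 := by
    have : 0 < u * (1 - u) := mul_pos hu0 (by linarith)
    positivity
  exact CardConsistency.twoSample_agreement_power hq hsA hVA0 hVB0 hA hB hVA hVB hm z

end Agreement

end Summit.Ventures.LatticeQCDFlow.Scoring.GlivenkoCantelli

end
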